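import Literature.Computability.AlgebraicComplexity.SupportRank
import Literature.Computability.AlgebraicComplexity.TensorMultiples
import HarnessLib

/-!
# Cohn–Umans 2013, Theorem 6 (weight removal: `ω ≤ (3ω_s − 2)/2`) — proved

Topic `Literature/Computability/AlgebraicComplexity`; sibling of `SupportRank.lean`, which vendors
H. Cohn, C. Umans, *Fast matrix multiplication using coherent configurations*, SODA 2013 =
arXiv:1207.6528 [CohnUmans2013], §3 (s-rank `R_s`, `ω_s`, Prop. 5, Thm. 6) as definitions and named
facts over the tree's coordinate tensors (`tensorRank = R`, `matMulTensor K k m n = ⟨k,m,n⟩`,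
`omega K = ω(K)`; `supportRank = R_s`, `sAdmissibleExponents`, `omegaS K = ω_s(K)`).  This file
DISCHARGES the named fact `CohnUmans2013_thm_6 : omega ℂ ≤ (3 * omegaS ℂ - 2) / 2`
(`CohnUmans2013_thm_6_holds`), proving it over every field `K`
(`CohnUmans2013Thm6.omega_le_three_mul_omegaS_sub_two_div_two`).

## The printed proof (CohnUmans2013, proof of Thm. 6, pp. 6–7 of the arXiv text) and its transcription

"By the definition of `ω_s`, `R_s(⟨n,n,n⟩) = n^{ω_s+o(1)}`.  Let `T = ∑ λ_{a,b,c} x_{a,b} y_{b,c} z_{c,a}`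
(`λ ≠ 0`) be the corresponding weighted matrix multiplication tensor, `S ⊆ Δ_n` a triangle-free set
(`s,t,u ∈ S`, `s₁ = t₁`, `t₂ = u₂`, `u₃ = s₃ ⇒ s = t = u`) with `|S| = n^{2-o(1)}` [CKSU05, §6.2], and
`T'` the direct sum of `|S|` independent `n² × n²` matrix multiplications.  `T'` is a restriction of
`T^{⊗3}` (substitute `u_{s,i,j'} = λ_{i₂,j'₁,s₂} x_{(i₁,i₂,s₃),(s₁,j'₁,j'₂)}`,
`v_{t,j,k'} = λ_{t₃,j₂,k'₂} y_{(t₁,j₁,j₂),(k'₁,t₂,k'₂)}`, `w_{u,k,i'} = λ_{i'₁,u₁,k₁} z_{(k₁,u₂,k₂),(i'₁,i'₂,u₃)}`,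
all other variables `0`), so `R(T') ≤ R(T)³`; by the asymptotic sum inequality
`n^{2-o(1)} n^{2ω} ≤ (n^{ω_s+o(1)})³`, and `2 + 2ω ≤ 3ω_s`."

Transcription (namespace `CohnUmans2013Thm6`), in the order of the printed proof:

* `tensorRank_smul_precomp_le` — substituting rescaled variables (and zero) does not increase the
  rank: `R((a,b,c) ↦ α_a β_b γ_c · t(f a, g b, h c)) ≤ R(t)` (the kind of restriction used above).
* `tensorRank_multiple_matMulTensor_le_cube` — **the core of the printed proof**: for `T` with the
  support of `⟨n,n,n⟩` and a triangle-free family `σ : Fin F → [n]³`,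
  `R(F ⊙ ⟨n·n, n·n, n·n⟩) ≤ R(T ⊗ T ⊗ T) ≤ R(T)³`, by exactly the substitution displayed above
  (written in the tree's index convention `⟨k,m,n⟩((i,k),(i',j),(j',k')) = [i=i' ∧ j=j' ∧ k=k']`,
  `F ⊙ t = ⟨F⟩ ⊗ t = kroneckerTensor (unitTensor K F) t`).
* `card_mul_rpow_omega_le` — the asymptotic-sum-inequality step, per `n`:
  `F · (n·n)^{ω} ≤ 2 R(T)³`.  DEVIATION: instead of Schönhage's general inequality we use the tree's
  proved one-format case, Bläser 2013 Lemma 7.7 (`Blaser2013_lemma77_rpow`: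
  `R(F ⊙ ⟨N,N,N⟩) ≤ qF ⇒ N^{ω} ≤ q`, with `q = ⌊R(T)³/F⌋ + 1` and `F ≤ R(F ⊙ ⟨N,N,N⟩)` by flattening),
  which costs a factor `2`, irrelevant in the limit.
* `exists_triangleFree` — a triangle-free family of size `m · r₃(m)` in `[3m]³`, where
  `r₃(m) = rothNumberNat m ≥ m e^{-4√log m}` (Behrend; Mathlib `Behrend.roth_lower_bound`), hence of
  size `n^{2-o(1)}` for `n = 3m`.  DEVIATION: the paper takes the triangle-free subsets of
  `Δ_n = {s₁+s₂+s₃ = n+2}` of [CKSU05, §6.2]; we use the (older, equivalent-size) Ruzsa–Szemerédi family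
  `{(a, a+b, a+2b) : a < m, b ∈ B}` for a three-term-progression-free `B ⊆ [m]` — a triangle
  `s₁ = t₁, t₂ = u₂, u₃ = s₃` forces a three-term progression in `B`.  (Membership in `Δ_n` is used in
  print only to let two coordinates determine the third, which triangle-freeness already implies and
  which the restriction argument does not need.)
* (from `SupportRank.lean`, already proved there: `sq_le_supportRank_matMulTensor` — "every tensor
  having the same support as `⟨n,n,n⟩` has `n²` linearly independent slices, `R_s(⟨n,n,n⟩) ≥ n²`" —
  and `sAdmissibleExponents_two_le`, `sAdmissibleExponents_nonempty`, needed to read `ω_s = inf`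
  honestly.)
* `two_add_two_mul_omega_le` — "taking logarithms and letting `n → ∞`": for every `τ` with
  `R_s(⟨n,n,n⟩) = O(n^τ)`, `2 + 2ω ≤ 3τ`; then `omega_le_three_mul_omegaS_sub_two_div_two` by
  `ω_s = inf` of such `τ`, and the discharge `CohnUmans2013_thm_6_holds` (`K = ℂ`).

No new definitions, no new named facts (D-0026): theorems only.

## References

* H. Cohn, C. Umans, *Fast matrix multiplication using coherent configurations*, Proc. 24th
  ACM-SIAM SODA (2013) 1074–1087 = arXiv:1207.6528, §3, Thm. 6 and its proof (held:
  `paper:arxiv-1207.6528`, pp. 6–7). [CohnUmans2013]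
* H. Cohn, R. Kleinberg, B. Szegedy, C. Umans, *Group-theoretic algorithms for matrix
  multiplication*, FOCS 2005, §6.2 (triangle-free sets). [CohnKleinbergSzegedyUmans2005]
* M. Bläser, *Fast Matrix Multiplication*, Theory of Computing Graduate Surveys 5 (2013), Lemma 7.7
  (tree: `TensorMultiples.lean`). [Blaser2013]
* F. A. Behrend, *On sets of integers which contain no three terms in arithmetical progression*,
  Proc. Nat. Acad. Sci. USA 32 (1946) 331–332 (Mathlib `Combinatorics.Additive.AP.Three.Behrend`).
-/

noncomputable section

open scoped BigOperators
open Filter Asymptotics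

namespace Literature.Computability.AlgebraicComplexity

universe u

namespace CohnUmans2013Thm6

/-! ## Rescaled restrictions along index maps -/

section Restrict

variable {K : Type u} [CommSemiring K] {ι κ μ ι' κ' μ' : Type*}

/-- **Substituting rescaled variables does not increase the rank**: for index maps `f, g, h` and
scalings `α, β, γ`, `R((a,b,c) ↦ α a · β b · γ c · t (f a) (g b) (h c)) ≤ R(t)` (each triad
`w ⊗ u ⊗ v` becomes the triad `(α · w ∘ f) ⊗ (β · u ∘ g) ⊗ (γ · v ∘ h)`; this is the substitution
"`u = λ x`, other variables `0`" of the proof of CU13 Thm. 6, i.e. Bläser 2013, Lemma 5.4 for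
monomial maps). [cite: CohnUmans2013, Thm. 6 (proof)] -/
theorem tensorRank_smul_precomp_le [Fintype ι] [Fintype κ] [Fintype μ] (t : ι → κ → μ → K)
    (f : ι' → ι) (g : κ' → κ) (h : μ' → μ) (α : ι' → K) (β : κ' → K) (γ : μ' → K) :
    tensorRank (fun a b c => α a * β b * γ c * t (f a) (g b) (h c)) ≤ tensorRank t := by
  obtain ⟨w, u, v, e⟩ := exists_triad_decomposition_tensorRank t
  refine tensorRank_le_of_eq_sum (fun i a => α a * w i (f a)) (fun i b => β b * u i (g b))
    (fun i c => γ c * v i (h c)) ?_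
  funext a b c
  conv_lhs => rw [e]
  rw [sum_triad_apply, sum_triad_apply, Finset.mul_sum]
  exact Finset.sum_congr rfl fun i _ => by ring

/-- `x⁻¹ y⁻¹ z⁻¹ · (x (y z)) = 1` for non-zero `x, y, z` in a field (the normalisation of the
coefficient after the substitution in the proof of CU13 Thm. 6). [folklore] -/
theorem inv_mul_inv_mul_inv_mul_eq_one {F : Type*} [Field F] {x y z : F} (hx : x ≠ 0) (hy : y ≠ 0)
    (hz : z ≠ 0) : x⁻¹ * y⁻¹ * z⁻¹ * (x * (y * z)) = 1 := by
  field_simp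

end Restrict

/-! ## Entries and support of `⟨k, m, n⟩` -/

section Support

variable (K : Type u) [CommSemiring K]

/-- Entries of `⟨k,m,n⟩` on explicit pairs: `⟨k,m,n⟩((x,z),(x',y),(y',z')) = [x = x' ∧ y = y' ∧ z = z']`.
[cite: Blaser2013, §5 (the tensor ⟨k,m,n⟩)] -/
theorem matMulTensor_mk (k m n : ℕ) (x : Fin k) (z : Fin n) (x' : Fin k) (y : Fin m) (y' : Fin m)
    (z' : Fin n) :
    matMulTensor K k m n (x, z) (x', y) (y', z') = if x = x' ∧ y = y' ∧ z = z' then 1 else 0 := rfl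

/-- The support of `⟨k,m,n⟩` (over a non-trivial semiring): the entry at `(a, b, c)` is non-zero iff
`a.1 = b.1`, `b.2 = c.1`, `a.2 = c.2`. [cite: Blaser2013, §5 (the tensor ⟨k,m,n⟩)] -/
theorem matMulTensor_ne_zero_iff [Nontrivial K] {k m n : ℕ} (a : Fin k × Fin n) (b : Fin k × Fin m)
    (c : Fin m × Fin n) :
    matMulTensor K k m n a b c ≠ 0 ↔ (a.1 = b.1 ∧ b.2 = c.1 ∧ a.2 = c.2) := by
  unfold matMulTensor
  split_ifs with h
  · simp [h]
  · simp [h]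

end Support

/-! ## `R_s` is attained -/

section SliceBound

variable (K : Type u) [Field K]

/-- For finite formats the infimum defining `R_s` is attained: some tensor with the same support has
rank `R_s(t)` (the tensor "`T`" of the proof of CU13 Thm. 6, of rank exactly `R_s(⟨n,n,n⟩)`).
[cite: CohnUmans2013, Def. 1] -/
theorem exists_sameSupport_tensorRank_eq {ι κ μ : Type*} [Fintype ι] [Fintype κ] [Fintype μ]
    (t : ι → κ → μ → K) : ∃ t' : ι → κ → μ → K, SameSupport t t' ∧ tensorRank t' = supportRank t :=
  Nat.sInf_mem (s := {r : ℕ | ∃ t' : ι → κ → μ → K, SameSupport t t' ∧ tensorRank t' = r})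
    ⟨_, _, SameSupport.refl _, rfl⟩

end SliceBound

/-! ## The core of the proof: `|S| ⊙ ⟨n², n², n²⟩` is a restriction of `T ⊗ T ⊗ T` -/

section Core

variable (K : Type u) [Field K] {n : ℕ}

/-- **CU13, proof of Thm. 6 — the restriction.**  Let `T` have the support of `⟨n,n,n⟩` (a weighted
matrix multiplication tensor, weights `λ_{i,j,k} = T((i,k),(i,j),(j,k)) ≠ 0`) and let
`σ : Fin F → [n]³` be a *triangle-free* family: `σ j₁ = σ l₁`, `σ l₂ = σ i₂`, `σ i₃ = σ j₃` only if
`i = j = l` (for `s = σ j`, `t = σ l`, `u = σ i` this is "`s₁ = t₁`, `t₂ = u₂`, `u₃ = s₃` imply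
`s = t = u`").  Then the direct sum of `F` copies of `⟨n·n, n·n, n·n⟩` is a restriction of
`T^{⊗3}`: in the tree's convention (`x_{i,j}` = second index set, `y_{j,k}` = third, `z` = first,
pairs `[n]² ≅ Fin (n·n)` by `finProdFinEquiv`) substitute, for copy `β` and `i, j, k ∈ [n]²`,
`x`-variable `((i₁, s₁), ((i₂, j₁), (s₃, j₂)))`, `y`-variable `((t₁, k₁), ((j₁, t₂), (j₂, k₂)))`,
`z`-variable `((i₁, k₁), ((i₂, u₂), (u₃, k₂)))` (`s = t = u = σ β`), rescaled by the inverses of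
`λ_{i₂,j₁,s₂}`, `λ_{t₃,j₂,k₂}`, `λ_{i₁,u₁,k₁}`, all other variables `0`; a monomial of `T^{⊗3}`
survives iff `i = i'`, `j = j'`, `k = k'`, `s₁ = t₁`, `t₂ = u₂`, `u₃ = s₃`, i.e. (triangle-free) iff
it is a term of the `β`-th copy, and then its coefficient `λλλ` is cancelled by the rescaling.
Hence `R(F ⊙ ⟨n·n,n·n,n·n⟩) ≤ R(T ⊗ T ⊗ T) ≤ R(T)³`. [cite: CohnUmans2013, Thm. 6 (proof)] -/
theorem tensorRank_multiple_matMulTensor_le_cube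
    {T : Fin n × Fin n → Fin n × Fin n → Fin n × Fin n → K}
    (hT : SameSupport (matMulTensor K n n n) T) {F : ℕ} (σ : Fin F → Fin n × Fin n × Fin n)
    (hσ : ∀ i j l, (σ j).1 = (σ l).1 → (σ l).2.1 = (σ i).2.1 → (σ i).2.2 = (σ j).2.2 →
      i = j ∧ j = l) :
    tensorRank (kroneckerTensor (unitTensor K F) (matMulTensor K (n * n) (n * n) (n * n))) ≤
      tensorRank T ^ 3 := by
  classical
  have hsupp : ∀ a b c, T a b c ≠ 0 ↔ (a.1 = b.1 ∧ b.2 = c.1 ∧ a.2 = c.2) := fun a b c =>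
    (hT a b c).symm.trans (matMulTensor_ne_zero_iff K a b c)
  -- `R(T ⊗ T ⊗ T) ≤ R(T)³`
  have hR3 : tensorRank (kroneckerTensor T (kroneckerTensor T T)) ≤ tensorRank T ^ 3 :=
    calc tensorRank (kroneckerTensor T (kroneckerTensor T T))
        ≤ tensorRank T * tensorRank (kroneckerTensor T T) := Blaser2013_lemma58 _ _
      _ ≤ tensorRank T * (tensorRank T * tensorRank T) :=
          Nat.mul_le_mul_left _ (Blaser2013_lemma58 _ _)
      _ = tensorRank T ^ 3 := by ring
  refine le_trans ?_ hR3
  -- pairs `[n]² ≅ Fin (n·n)`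
  obtain ⟨e, heinj⟩ : ∃ e : Fin (n * n) → Fin n × Fin n, Function.Injective e :=
    ⟨fun I => finProdFinEquiv.symm I, fun I J h => finProdFinEquiv.symm.injective h⟩
  -- the index maps of the substitution (first index set `z`, second `x`, third `y`)
  obtain ⟨φ, hφ⟩ : ∃ φ : Fin F × (Fin (n * n) × Fin (n * n)) →
      (Fin n × Fin n) × ((Fin n × Fin n) × (Fin n × Fin n)), ∀ a, φ a =
        (((e a.2.1).1, (e a.2.2).1), (((e a.2.1).2, (σ a.1).2.1), ((σ a.1).2.2, (e a.2.2).2))) :=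
    ⟨_, fun _ => rfl⟩
  obtain ⟨ψ, hψ⟩ : ∃ ψ : Fin F × (Fin (n * n) × Fin (n * n)) →
      (Fin n × Fin n) × ((Fin n × Fin n) × (Fin n × Fin n)), ∀ b, ψ b =
        (((e b.2.1).1, (σ b.1).1), (((e b.2.1).2, (e b.2.2).1), ((σ b.1).2.2, (e b.2.2).2))) :=
    ⟨_, fun _ => rfl⟩
  obtain ⟨χ, hχ⟩ : ∃ χ : Fin F × (Fin (n * n) × Fin (n * n)) →
      (Fin n × Fin n) × ((Fin n × Fin n) × (Fin n × Fin n)), ∀ c, χ c =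
        (((σ c.1).1, (e c.2.2).1), (((e c.2.1).1, (σ c.1).2.1), ((e c.2.1).2, (e c.2.2).2))) :=
    ⟨_, fun _ => rfl⟩
  -- the rescalings (inverses of the weights `λ`)
  obtain ⟨α, hα⟩ : ∃ α : Fin F × (Fin (n * n) × Fin (n * n)) → K, ∀ a, α a =
      (T ((e a.2.1).1, (e a.2.2).1) ((e a.2.1).1, (σ a.1).1) ((σ a.1).1, (e a.2.2).1))⁻¹ :=
    ⟨_, fun _ => rfl⟩
  obtain ⟨β, hβ⟩ : ∃ β : Fin F × (Fin (n * n) × Fin (n * n)) → K, ∀ b, β b =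
      (T ((e b.2.1).2, (σ b.1).2.1) ((e b.2.1).2, (e b.2.2).1) ((e b.2.2).1, (σ b.1).2.1))⁻¹ :=
    ⟨_, fun _ => rfl⟩
  obtain ⟨γ, hγ⟩ : ∃ γ : Fin F × (Fin (n * n) × Fin (n * n)) → K, ∀ c, γ c =
      (T ((σ c.1).2.2, (e c.2.2).2) ((σ c.1).2.2, (e c.2.1).2) ((e c.2.1).2, (e c.2.2).2))⁻¹ :=
    ⟨_, fun _ => rfl⟩
  have key : kroneckerTensor (unitTensor K F) (matMulTensor K (n * n) (n * n) (n * n)) =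
      fun a b c => α a * β b * γ c * kroneckerTensor T (kroneckerTensor T T) (φ a) (ψ b) (χ c) := by
    funext a b c
    obtain ⟨β₁, A₁, A₂⟩ := a
    obtain ⟨β₂, B₁, B₂⟩ := b
    obtain ⟨β₃, C₁, C₂⟩ := c
    show kroneckerTensor (unitTensor K F) (matMulTensor K (n * n) (n * n) (n * n)) (β₁, A₁, A₂)
        (β₂, B₁, B₂) (β₃, C₁, C₂) = α (β₁, A₁, A₂) * β (β₂, B₁, B₂) * γ (β₃, C₁, C₂) *
        kroneckerTensor T (kroneckerTensor T T) (φ (β₁, A₁, A₂)) (ψ (β₂, B₁, B₂)) (χ (β₃, C₁, C₂))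
    rw [kroneckerTensor_unitTensor_apply, hφ, hψ, hχ, hα, hβ, hγ]
    simp only [kroneckerTensor_apply, matMulTensor_mk]
    by_cases hdiag : β₁ = β₂ ∧ β₂ = β₃ ∧ A₁ = B₁ ∧ B₂ = C₁ ∧ A₂ = C₂
    · -- a term of one of the `F` copies: coefficient `1` on both sides
      obtain ⟨h12, h23, hAB, hBC, hAC⟩ := hdiag
      subst β₂
      subst β₃
      subst B₁
      subst C₁
      subst C₂
      rw [if_pos (show β₁ = β₁ ∧ β₁ = β₁ from ⟨rfl, rfl⟩),
        if_pos (show A₁ = A₁ ∧ B₂ = B₂ ∧ A₂ = A₂ from ⟨rfl, rfl, rfl⟩)]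
      have h1 : T ((e A₁).1, (e A₂).1) ((e A₁).1, (σ β₁).1) ((σ β₁).1, (e A₂).1) ≠ 0 :=
        (hsupp _ _ _).2 ⟨rfl, rfl, rfl⟩
      have h2 : T ((e A₁).2, (σ β₁).2.1) ((e A₁).2, (e B₂).1) ((e B₂).1, (σ β₁).2.1) ≠ 0 :=
        (hsupp _ _ _).2 ⟨rfl, rfl, rfl⟩
      have h3 : T ((σ β₁).2.2, (e A₂).2) ((σ β₁).2.2, (e B₂).2) ((e B₂).2, (e A₂).2) ≠ 0 :=
        (hsupp _ _ _).2 ⟨rfl, rfl, rfl⟩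
      exact (inv_mul_inv_mul_inv_mul_eq_one h1 h2 h3).symm
    · -- any other monomial vanishes on both sides (triangle-freeness of `σ`)
      have hl : (if β₁ = β₂ ∧ β₂ = β₃ then (if A₁ = B₁ ∧ B₂ = C₁ ∧ A₂ = C₂ then (1 : K) else 0)
          else 0) = 0 := by
        split_ifs with h1 h2
        · exact absurd ⟨h1.1, h1.2, h2.1, h2.2.1, h2.2.2⟩ hdiag
        · rfl
        · rfl
      rw [hl, eq_comm]
      refine mul_eq_zero_of_right _ ?_
      by_contra hne
      obtain ⟨hne1, hne23⟩ := mul_ne_zero_iff.1 hne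
      obtain ⟨hne2, hne3⟩ := mul_ne_zero_iff.1 hne23
      obtain ⟨h11, h12, h13⟩ := (hsupp _ _ _).1 hne1
      obtain ⟨h21, h22, h23⟩ := (hsupp _ _ _).1 hne2
      obtain ⟨h31, h32, h33⟩ := (hsupp _ _ _).1 hne3
      dsimp only at h11 h12 h13 h21 h22 h23 h31 h32 h33
      obtain ⟨e12, e23⟩ := hσ β₁ β₂ β₃ h12 h23.symm h31
      refine hdiag ⟨e12, e23, heinj (Prod.ext h11 h21), heinj (Prod.ext h22 h32),
        heinj (Prod.ext h13 h33)⟩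
  rw [key]
  exact tensorRank_smul_precomp_le _ φ ψ χ α β γ

/-- **CU13, proof of Thm. 6 — the rank count, per `n`.**  With `T`, `σ` as above, `F ≥ 1` and
`n ≥ 2`: `F · (n·n)^{ω} ≤ 2 R(T)³`.  Printed: "the ordinary rank of the direct sum of `|S|`
independent `n² × n²` matrix multiplications is at most `R(T)³`, and applying the asymptotic sum
inequality we get `|S| n^{2ω} ≤ R(T)³`"; here the one-format asymptotic sum inequality is taken in
the tree's proved form Bläser 2013, Lemma 7.7 (`R(F ⊙ ⟨N,N,N⟩) ≤ qF ⇒ (N³)^{ω/3} ≤ q`, with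
`q = ⌊R(T)³/F⌋ + 1`, `N = n·n`), at the price of the factor `2` (`qF ≤ R(T)³ + F ≤ 2R(T)³` by the
flattening bound `F ≤ R(F ⊙ ⟨N,N,N⟩)`). [cite: CohnUmans2013, Thm. 6 (proof)] -/
theorem card_mul_rpow_omega_le (hn : 2 ≤ n)
    {T : Fin n × Fin n → Fin n × Fin n → Fin n × Fin n → K}
    (hT : SameSupport (matMulTensor K n n n) T) {F : ℕ} (hF : 1 ≤ F)
    (σ : Fin F → Fin n × Fin n × Fin n)
    (hσ : ∀ i j l, (σ j).1 = (σ l).1 → (σ l).2.1 = (σ i).2.1 → (σ i).2.2 = (σ j).2.2 →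
      i = j ∧ j = l) :
    (F : ℝ) * ((n : ℝ) * n) ^ omega K ≤ 2 * (tensorRank T : ℝ) ^ 3 := by
  set N := n * n with hN
  set g := tensorRank T ^ 3 with hg
  have hle : tensorRank (kroneckerTensor (unitTensor K F) (matMulTensor K N N N)) ≤ g :=
    tensorRank_multiple_matMulTensor_le_cube K hT σ hσ
  have hn0 : 0 < n := by omega
  have hN0 : 0 < N := Nat.mul_pos hn0 hn0
  have hN2 : 2 ≤ N * N * N := by
    have h4 : 4 ≤ N := by rw [hN]; nlinarith
    calc 2 ≤ 4 := by norm_num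
      _ ≤ N := h4
      _ ≤ N * N := Nat.le_mul_of_pos_right _ hN0
      _ ≤ N * N * N := Nat.le_mul_of_pos_right _ hN0
  -- flattening: `F ≤ R(F ⊙ ⟨N,N,N⟩) ≤ g`
  have hFg : F ≤ g := by
    refine le_trans (le_tensorRank_multiple F (matMulTensor K N N N)
      (a₀ := (⟨0, hN0⟩, ⟨0, hN0⟩)) (b₀ := (⟨0, hN0⟩, ⟨0, hN0⟩)) (c₀ := (⟨0, hN0⟩, ⟨0, hN0⟩)) ?_) hle
    simp [matMulTensor]
  -- Lemma 7.7 with `q = ⌊g/F⌋ + 1`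
  set q : ℕ := g / F + 1 with hq
  have hFpos : 0 < F := hF
  have hqF : g ≤ q * F := by
    rw [hq, Nat.add_mul, one_mul, mul_comm]
    have := Nat.div_add_mod g F
    have := Nat.mod_lt g hFpos
    omega
  have h77 := Blaser2013_lemma77_rpow K hF hN2 (hle.trans hqF)
  have hqF' : (F : ℝ) * q ≤ 2 * (g : ℝ) := by
    have h3 : F * q ≤ g + F := by
      rw [hq, Nat.mul_add, mul_one]
      exact Nat.add_le_add_right (Nat.mul_div_le g F) F
    have h4 : ((F * q : ℕ) : ℝ) ≤ ((g + F : ℕ) : ℝ) := by exact_mod_cast h3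
    have h5 : (F : ℝ) ≤ g := by exact_mod_cast hFg
    push_cast at h4
    linarith
  -- `(N³)^{ω/3} = (n·n)^ω`
  have hpow : ((N * N * N : ℕ) : ℝ) ^ (omega K / 3) = ((n : ℝ) * n) ^ omega K := by
    have hcast : ((N * N * N : ℕ) : ℝ) = ((n : ℝ) * n) ^ (3 : ℕ) := by
      rw [hN]; push_cast; ring
    rw [hcast, ← Real.rpow_natCast, ← Real.rpow_mul (by positivity)]
    congr 1
    push_cast
    ring
  rw [hpow] at h77
  have hg' : (g : ℝ) = (tensorRank T : ℝ) ^ 3 := by rw [hg, Nat.cast_pow]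
  calc (F : ℝ) * ((n : ℝ) * n) ^ omega K ≤ (F : ℝ) * q :=
      mul_le_mul_of_nonneg_left h77 (Nat.cast_nonneg _)
    _ ≤ 2 * (g : ℝ) := hqF'
    _ = 2 * (tensorRank T : ℝ) ^ 3 := by rw [hg']

end Core

/-! ## Triangle-free families of size `n^{2-o(1)}` (Behrend / Ruzsa–Szemerédi) -/

section TriangleFree

/-- **A triangle-free family of size `m · r₃(m)` in `[3m]³`.**  For a three-term-progression-free
`B ⊆ {0,…,m-1}` of size `r₃(m) = rothNumberNat m` (Mathlib), the triples `(a, a+b, a+2b)`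
(`a < m`, `b ∈ B`) form a triangle-free family: `s₁ = t₁`, `t₂ = u₂`, `u₃ = s₃` for
`s = (a, a+b, a+2b)`, `t = (a', …)`, `u = (a'', …)` give `a = a'`, `a'+b' = a''+b''`,
`a''+2b'' = a+2b`, so `b' + b'' = 2b` and `b' = b = b''`, `a'' = a`.  This replaces the triangle-free
subsets of `Δ_n` of CKSU 2005, §6.2 used in print (same size `n^{2-o(1)}` by Behrend's bound
`r₃(m) ≥ m e^{-4√log m}`). [cite: CohnUmans2013, Thm. 6 (proof)] -/
theorem exists_triangleFree (m : ℕ) :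
    ∃ σ : Fin (m * rothNumberNat m) → Fin (3 * m) × Fin (3 * m) × Fin (3 * m),
      ∀ i j l, (σ j).1 = (σ l).1 → (σ l).2.1 = (σ i).2.1 → (σ i).2.2 = (σ j).2.2 →
        i = j ∧ j = l := by
  classical
  obtain ⟨B, hBm, hBcard, hfree⟩ := rothNumberNat_spec m
  have hBlt : ∀ b ∈ B, b < m := fun b hb => Finset.mem_range.1 (hBm hb)
  have hbd : ∀ p : Fin m × B, (p.1 : ℕ) + 2 * (p.2 : ℕ) < 3 * m := fun p => by
    have h1 := p.1.isLt
    have h2 := hBlt _ p.2.2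
    omega
  -- the parametrisation `(a, b) ↦ (a, a + b, a + 2b)`
  obtain ⟨g, hg⟩ : ∃ g : Fin m × B → Fin (3 * m) × Fin (3 * m) × Fin (3 * m), ∀ p,
      ((g p).1 : ℕ) = p.1 ∧ ((g p).2.1 : ℕ) = p.1 + p.2 ∧ ((g p).2.2 : ℕ) = p.1 + 2 * p.2 :=
    ⟨fun p => (⟨p.1, by have := hbd p; omega⟩, ⟨p.1 + p.2, by have := hbd p; omega⟩,
      ⟨p.1 + 2 * p.2, hbd p⟩), fun p => ⟨rfl, rfl, rfl⟩⟩
  have hcard : Fintype.card (Fin m × B) = m * rothNumberNat m := by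
    rw [Fintype.card_prod, Fintype.card_fin, Fintype.card_coe, hBcard]
  set ε := (Fintype.equivFinOfCardEq hcard).symm
  obtain ⟨σ, hσ⟩ : ∃ σ : Fin (m * rothNumberNat m) → Fin (3 * m) × Fin (3 * m) × Fin (3 * m),
      ∀ i, σ i = g (ε i) := ⟨_, fun _ => rfl⟩
  refine ⟨σ, fun i j l h1 h2 h3 => ?_⟩
  -- pass to natural-number coordinates
  rw [hσ, hσ] at h1 h2 h3
  have h1' := congrArg Fin.val h1
  have h2' := congrArg Fin.val h2
  have h3' := congrArg Fin.val h3
  rw [(hg _).1, (hg _).1] at h1'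
  rw [(hg _).2.1, (hg _).2.1] at h2'
  rw [(hg _).2.2, (hg _).2.2] at h3'
  -- `b_l + b_i = 2 b_j`: a three-term progression in `B`, hence trivial
  have hAP : ((ε l).2 : ℕ) + ((ε i).2 : ℕ) = ((ε j).2 : ℕ) + ((ε j).2 : ℕ) := by omega
  have hb : ((ε l).2 : ℕ) = ((ε j).2 : ℕ) := hfree (ε l).2.2 (ε j).2.2 (ε i).2.2 hAP
  have hbi : ((ε i).2 : ℕ) = ((ε j).2 : ℕ) := by omega
  have hai : ((ε i).1 : ℕ) = ((ε j).1 : ℕ) := by omega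
  have hij : ε i = ε j := Prod.ext (Fin.ext hai) (Subtype.ext hbi)
  have hjl : ε j = ε l := Prod.ext (Fin.ext h1') (Subtype.ext hb.symm)
  exact ⟨ε.injective hij, ε.injective hjl⟩

/-- `r₃(m) ≥ 1` for `m ≥ 1` (from Behrend's bound `m e^{-4√log m} ≤ r₃(m)`). [folklore] -/
theorem one_le_rothNumberNat {m : ℕ} (hm : 1 ≤ m) : 1 ≤ rothNumberNat m := by
  have h := Behrend.roth_lower_bound (N := m)
  have hpos : (0 : ℝ) < (m : ℝ) * Real.exp (-4 * Real.sqrt (Real.log m)) := by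
    have : (0 : ℝ) < m := by exact_mod_cast hm
    positivity
  have : (0 : ℝ) < rothNumberNat m := hpos.trans_le h
  exact_mod_cast this

end TriangleFree

/-! ## Assembly: `2 + 2ω ≤ 3τ` for every s-admissible `τ` -/

section Assembly

variable (K : Type u) [Field K]

/-- **The inequality of the proof of CU13 Thm. 6 at `n = 3m`** (`m ≥ 1`):
`m · r₃(m) · ((3m)·(3m))^{ω} ≤ 2 R_s(⟨3m,3m,3m⟩)³` — take `T` with the support of `⟨n,n,n⟩` and
`R(T) = R_s(⟨n,n,n⟩)`, the triangle-free family of `exists_triangleFree`, and `card_mul_rpow_omega_le`.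
[cite: CohnUmans2013, Thm. 6 (proof)] -/
theorem mul_roth_mul_rpow_omega_le {m : ℕ} (hm : 1 ≤ m) :
    ((m * rothNumberNat m : ℕ) : ℝ) * (((3 * m : ℕ) : ℝ) * ((3 * m : ℕ) : ℝ)) ^ omega K ≤
      2 * (supportRank (matMulTensor K (3 * m) (3 * m) (3 * m)) : ℝ) ^ 3 := by
  obtain ⟨T, hT, hTr⟩ := exists_sameSupport_tensorRank_eq K (matMulTensor K (3 * m) (3 * m) (3 * m))
  obtain ⟨σ, hσ⟩ := exists_triangleFree m
  have hF : 1 ≤ m * rothNumberNat m := Nat.mul_pos (by omega) (one_le_rothNumberNat hm)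
  have h := card_mul_rpow_omega_le K (n := 3 * m) (by omega) hT hF σ hσ
  rw [hTr] at h
  exact_mod_cast h

/-- **CU13 Thm. 6, exponent form: `2 + 2ω ≤ 3τ` whenever `R_s(⟨n,n,n⟩) = O(n^τ)`** ("taking
logarithms and letting `n` go to infinity").  From `mul_roth_mul_rpow_omega_le`, Behrend's bound
`r₃(m) ≥ m e^{-4√log m}` and `R_s(⟨3m,3m,3m⟩) ≤ C (3m)^τ`:
`2 log m − 4√(log m) + 2ω log(3m) ≤ log(2C³) + 3τ log(3m)` for all large `m`, impossible if
`2 + 2ω − 3τ > 0`. [cite: CohnUmans2013, Thm. 6] -/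
theorem two_add_two_mul_omega_le {τ : ℝ} (hτ : τ ∈ sAdmissibleExponents K) :
    2 + 2 * omega K ≤ 3 * τ := by
  by_contra hlt
  rw [not_le] at hlt
  -- `δ = 2 + 2ω - 3τ > 0`
  have hδ : 0 < 2 + 2 * omega K - 3 * τ := by linarith
  -- the `O`-constant
  obtain ⟨c, hc⟩ := isBigO_iff.1 hτ
  set C : ℝ := max c 1
  have hC1 : 1 ≤ C := le_max_right _ _
  have hC0 : 0 < C := by linarith
  obtain ⟨N₀, hN₀⟩ := eventually_atTop.1 hc
  -- the bounded quantity `L` of the contradiction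
  set L : ℝ := Real.log 2 + 3 * Real.log C + 3 * τ * Real.log 3 - 2 * omega K * Real.log 3 with hL
  -- choose `m` large
  have hev : ∀ᶠ m : ℕ in atTop, N₀ ≤ m ∧ ⌈Real.exp (64 / (2 + 2 * omega K - 3 * τ) ^ 2)⌉₊ ≤ m ∧
      ⌈Real.exp (2 * L / (2 + 2 * omega K - 3 * τ))⌉₊ < m ∧ 1 ≤ m := by
    filter_upwards [eventually_ge_atTop N₀,
      eventually_ge_atTop ⌈Real.exp (64 / (2 + 2 * omega K - 3 * τ) ^ 2)⌉₊,
      eventually_gt_atTop ⌈Real.exp (2 * L / (2 + 2 * omega K - 3 * τ))⌉₊,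
      eventually_ge_atTop 1] with m h1 h2 h3 h4
    exact ⟨h1, h2, h3, h4⟩
  obtain ⟨m, hmN, hm64, hmL, hm1⟩ := hev.exists
  -- basic positivity
  have hm0 : (0 : ℝ) < m := by exact_mod_cast hm1
  have hm1' : (1 : ℝ) ≤ m := by exact_mod_cast hm1
  set x : ℝ := Real.log m with hx
  have hx0 : 0 ≤ x := Real.log_nonneg hm1'
  -- `x ≥ 64/δ²` and `x > 2L/δ`
  have hx64 : 64 / (2 + 2 * omega K - 3 * τ) ^ 2 ≤ x := by
    have h1 : Real.exp (64 / (2 + 2 * omega K - 3 * τ) ^ 2) ≤ m :=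
      le_trans (Nat.le_ceil _) (by exact_mod_cast hm64)
    have h2 := Real.log_le_log (Real.exp_pos _) h1
    rwa [Real.log_exp] at h2
  have hxL : 2 * L / (2 + 2 * omega K - 3 * τ) < x := by
    have h1 : Real.exp (2 * L / (2 + 2 * omega K - 3 * τ)) < m :=
      lt_of_le_of_lt (Nat.le_ceil _) (by exact_mod_cast hmL)
    have h2 := Real.log_lt_log (Real.exp_pos _) h1
    rwa [Real.log_exp] at h2
  -- hence `4 √x ≤ (δ/2) x` and `(δ/2) x > L`
  have hsqrt : 8 / (2 + 2 * omega K - 3 * τ) ≤ Real.sqrt x := by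
    refine Real.le_sqrt_of_sq_le ?_
    calc (8 / (2 + 2 * omega K - 3 * τ)) ^ 2 = 64 / (2 + 2 * omega K - 3 * τ) ^ 2 := by
          rw [div_pow]; norm_num
      _ ≤ x := hx64
  have hδne : (2 + 2 * omega K - 3 * τ) ≠ 0 := hδ.ne'
  have h8 : (2 + 2 * omega K - 3 * τ) / 2 * (8 / (2 + 2 * omega K - 3 * τ)) = 4 := by
    calc (2 + 2 * omega K - 3 * τ) / 2 * (8 / (2 + 2 * omega K - 3 * τ))
        = (2 + 2 * omega K - 3 * τ) / (2 + 2 * omega K - 3 * τ) * (8 / 2) := by ring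
      _ = 4 := by rw [div_self hδne]; norm_num
  have hH2 : 4 * Real.sqrt x ≤ (2 + 2 * omega K - 3 * τ) / 2 * x := by
    have hxx : Real.sqrt x * Real.sqrt x = x := Real.mul_self_sqrt hx0
    calc 4 * Real.sqrt x = (2 + 2 * omega K - 3 * τ) / 2 * (8 / (2 + 2 * omega K - 3 * τ)) *
          Real.sqrt x := by rw [h8]
      _ ≤ (2 + 2 * omega K - 3 * τ) / 2 * Real.sqrt x * Real.sqrt x :=
          mul_le_mul_of_nonneg_right (mul_le_mul_of_nonneg_left hsqrt (by positivity))
            (Real.sqrt_nonneg x)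
      _ = (2 + 2 * omega K - 3 * τ) / 2 * x := by rw [mul_assoc, hxx]
  have hH3 : L < (2 + 2 * omega K - 3 * τ) / 2 * x := by
    rw [div_lt_iff₀ hδ] at hxL
    linarith
  -- the main inequality at this `m`, and the bounds entering it
  have hmain := mul_roth_mul_rpow_omega_le K hm1
  have hroth : (m : ℝ) * Real.exp (-4 * Real.sqrt x) ≤ rothNumberNat m := by
    rw [hx]; exact Behrend.roth_lower_bound
  have hρ0 : 0 < (rothNumberNat m : ℝ) := lt_of_lt_of_le (by positivity) hroth
  have h3m : ((3 * m : ℕ) : ℝ) = 3 * (m : ℝ) := by push_cast; ring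
  have h3m0 : (0 : ℝ) < 3 * (m : ℝ) := by positivity
  set Rs : ℝ := (supportRank (matMulTensor K (3 * m) (3 * m) (3 * m)) : ℝ) with hRs
  have hRs1 : 1 ≤ Rs := by
    have h := sq_le_supportRank_matMulTensor K (3 * m)
    have h' : 1 ≤ (3 * m) ^ 2 := Nat.one_le_pow _ _ (by omega)
    rw [hRs]
    exact_mod_cast h'.trans h
  have hRs0 : 0 < Rs := by linarith
  have hRsC : Rs ≤ C * (3 * (m : ℝ)) ^ τ := by
    have h := hN₀ (3 * m) (by omega)
    rw [Real.norm_of_nonneg (Nat.cast_nonneg _),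
      Real.norm_of_nonneg (Real.rpow_nonneg (Nat.cast_nonneg _) _), h3m] at h
    refine h.trans ?_
    exact mul_le_mul_of_nonneg_right (le_max_left _ _) (Real.rpow_nonneg h3m0.le _)
  -- logarithms
  have hX0 : (0 : ℝ) < 3 * (m : ℝ) * (3 * m) := by positivity
  have hlog_33 : Real.log (3 * (m : ℝ) * (3 * m)) = 2 * (Real.log 3 + x) := by
    rw [Real.log_mul h3m0.ne' h3m0.ne', Real.log_mul (by norm_num) hm0.ne', hx]
    ring
  have hlog_main : x + Real.log (rothNumberNat m) + omega K * (2 * (Real.log 3 + x)) ≤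
      Real.log 2 + 3 * Real.log Rs := by
    have hmain' : (m : ℝ) * rothNumberNat m * (3 * (m : ℝ) * (3 * m)) ^ omega K ≤
        2 * Rs ^ 3 := by
      have h := hmain
      push_cast at h
      exact h
    have hlhs : (0 : ℝ) < (m : ℝ) * rothNumberNat m * (3 * (m : ℝ) * (3 * m)) ^ omega K :=
      mul_pos (mul_pos hm0 hρ0) (Real.rpow_pos_of_pos hX0 _)
    have h := Real.log_le_log hlhs hmain'
    rw [Real.log_mul (mul_pos hm0 hρ0).ne' (Real.rpow_pos_of_pos hX0 _).ne',
      Real.log_mul hm0.ne' hρ0.ne', Real.log_rpow hX0, hlog_33,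
      Real.log_mul (by norm_num) (pow_pos hRs0 3).ne', Real.log_pow, ← hx] at h
    push_cast at h
    linarith
  have hlog_Rs : Real.log Rs ≤ Real.log C + τ * (Real.log 3 + x) := by
    have h := Real.log_le_log hRs0 hRsC
    rw [Real.log_mul hC0.ne' (Real.rpow_pos_of_pos h3m0 _).ne', Real.log_rpow h3m0,
      Real.log_mul (by norm_num) hm0.ne', ← hx] at h
    exact h
  have hlog_roth : x - 4 * Real.sqrt x ≤ Real.log (rothNumberNat m) := by
    have h := Real.log_le_log (by positivity) hroth
    rw [Real.log_mul hm0.ne' (Real.exp_pos _).ne', Real.log_exp, ← hx] at h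
    linarith
  -- `δ x ≤ L + 4 √x ≤ L + δ x / 2`, contradicting `δ x / 2 > L`
  linarith [hlog_main, hlog_Rs, hlog_roth, hH2, hH3, hL]

/-- **Cohn–Umans 2013, Theorem 6, over any field `K`**: `ω(K) ≤ (3 ω_s(K) − 2)/2` — from
`two_add_two_mul_omega_le` for every s-admissible `τ` and `ω_s = inf` of the (non-empty) set of
s-admissible exponents. [cite: CohnUmans2013, Thm. 6] -/
theorem omega_le_three_mul_omegaS_sub_two_div_two : omega K ≤ (3 * omegaS K - 2) / 2 := by
  have h : (2 + 2 * omega K) / 3 ≤ omegaS K := by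
    unfold omegaS
    exact le_csInf (sAdmissibleExponents_nonempty K) fun τ hτ => by
      have := two_add_two_mul_omega_le K hτ
      linarith
  linarith

end Assembly

end CohnUmans2013Thm6

/-- DISCHARGE of the named fact `CohnUmans2013_thm_6` (`SupportRank.lean`) — **Cohn–Umans 2013,
Theorem 6**: "The exponents `ω` and `ω_s` satisfy `ω ≤ (3ω_s − 2)/2`" (over `ℂ`), by the printed
proof (triangle-free direct sum inside `T^{⊗3}` + asymptotic sum inequality), see the module
docstring of this file. [cite: CohnUmans2013, Thm. 6] -/
theorem CohnUmans2013_thm_6_holds : CohnUmans2013_thm_6 :=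
  CohnUmans2013Thm6.omega_le_three_mul_omegaS_sub_two_div_two ℂ

end Literature.Computability.AlgebraicComplexity

end
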